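import Mathlib
import HarnessLib
import Summits.Ventures.LatticeQCDFlow.Scaling.AbelianHolonomyNonDetermination

/-!
# LatticeQCDFlow / Scaling — counting undetermined plaquettes: `#B` plaquette holonomies of an abelian field
# leave at least `(d−1)(L^d − 1) − #B` plaquettes of the Morse structure undetermined

HONEST FRAMING: exact (Metropolis-corrected) sampling algorithms for lattice gauge theory;
figures of merit are autocorrelation/cost numbers at stated couplings and volumes; no
continuum-physics claim.

Venture `LatticeQCDFlow` (cell pub-lqcd), topic `Scaling`, FANOUT row 30 (lean-1, GEN-27) — OUR WORK on
THEORY-2.md §4 row C5 (gen25 Q2, the converse made quantitative).  `AbelianHolonomyNonDetermination` showed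
that fewer than `(d−1)(L^d − 1)` plaquettes leave SOME plaquette undetermined.  Counting with the Morse
structure (`TorusRankedMorseCount.exists_ranked_card_compl_eq`: `(d−1)(L^d − 1)` plaquettes whose signed
boundaries are `ℚ`-independent):

* **`card_le_of_signedBoundary_mem_span`** — among the Morse (or any ranked structure's) plaquettes, those whose boundary IS a rational
  combination of `{σ∂p : p ∈ B}` number at most `#B` (an independent family inside a space of dimension
  `≤ #B`);
* **`exists_card_not_determined`** — hence for every `B` and every commutative `G` with some `g^n ≠ 1` for each
  `n ≠ 0` (`U(1)`, `ℤ`, …) there is a set `D` of plaquettes, `#D + #B ≥ (d−1)(L^d − 1)`, EACH of which is not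
  determined by `B`: two `G`-configurations agree around every `p ∈ B` and differ around it.  The deficit
  `(d−1)(L^d − 1) − #B` of a non-full structure is a lower bound on the number of free plaquettes.

No `def`, no `sorry`, nothing cited as a fact beyond the tree.
-/

namespace Summit.Ventures.LatticeQCDFlow.Theory2.Autoregressive

open Finset
open Literature.MathematicalPhysics.QuantumFieldTheory

variable {d L : ℕ} [NeZero L]

/-- **At most `#B` plaquettes of a ranked structure have their boundary in the `ℚ`-span of `{σ∂p : p ∈ B}`**
(`L ≥ 2`; `(Mo, t, rank)` ranked, `B` arbitrary, `F ⊆ Mo` with all its boundaries in the span): the boundaries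
of `F` are `ℚ`-independent (`linearIndependent_signedBoundary_rat_of_ranked`) inside a space of dimension
`≤ #B`. [ours] -/
theorem card_le_of_signedBoundary_mem_span (hL : 2 ≤ L) (Mo : Finset (Plaquette d L))
    (t : Plaquette d L → Edge d L)
    (ht : ∀ p ∈ Mo, t p ∈ ({(p.1, p.2.1.1), (p.1.shift p.2.1.1, p.2.1.2),
        (p.1.shift p.2.1.2, p.2.1.1), (p.1, p.2.1.2)} : Finset (Edge d L)))
    (rank : Plaquette d L → ℕ)
    (hrank : ∀ p ∈ Mo, ∀ p' ∈ Mo, p ≠ p' → t p ∈ ({(p'.1, p'.2.1.1), (p'.1.shift p'.2.1.1, p'.2.1.2),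
        (p'.1.shift p'.2.1.2, p'.2.1.1), (p'.1, p'.2.1.2)} : Finset (Edge d L)) → rank p < rank p')
    (B F : Finset (Plaquette d L)) (hF : F ⊆ Mo)
    (hmem : ∀ p' ∈ F, (Pi.single (p'.1, p'.2.1.1) 1 + Pi.single (p'.1.shift p'.2.1.1, p'.2.1.2) 1 -
        Pi.single (p'.1.shift p'.2.1.2, p'.2.1.1) 1 - Pi.single (p'.1, p'.2.1.2) 1 : Edge d L → ℚ) ∈
      Submodule.span ℚ (Set.range fun p : B =>
        (Pi.single ((p : Plaquette d L).1, (p : Plaquette d L).2.1.1) 1 +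
        Pi.single ((p : Plaquette d L).1.shift (p : Plaquette d L).2.1.1, (p : Plaquette d L).2.1.2) 1 -
        Pi.single ((p : Plaquette d L).1.shift (p : Plaquette d L).2.1.2, (p : Plaquette d L).2.1.1) 1 -
        Pi.single ((p : Plaquette d L).1, (p : Plaquette d L).2.1.2) 1 : Edge d L → ℚ))) :
    F.card ≤ B.card := by
  classical
  set W := Submodule.span ℚ (Set.range fun p : B =>
        (Pi.single ((p : Plaquette d L).1, (p : Plaquette d L).2.1.1) 1 +
        Pi.single ((p : Plaquette d L).1.shift (p : Plaquette d L).2.1.1, (p : Plaquette d L).2.1.2) 1 -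
        Pi.single ((p : Plaquette d L).1.shift (p : Plaquette d L).2.1.2, (p : Plaquette d L).2.1.1) 1 -
        Pi.single ((p : Plaquette d L).1, (p : Plaquette d L).2.1.2) 1 : Edge d L → ℚ)) with hW
  have hliM := linearIndependent_signedBoundary_rat_of_ranked hL Mo t ht rank hrank
  -- restrict the family to `F` and view it inside `W`
  have hliF : LinearIndependent ℚ (fun p : F =>
      (Pi.single ((p : Plaquette d L).1, (p : Plaquette d L).2.1.1) 1 +
        Pi.single ((p : Plaquette d L).1.shift (p : Plaquette d L).2.1.1, (p : Plaquette d L).2.1.2) 1 -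
        Pi.single ((p : Plaquette d L).1.shift (p : Plaquette d L).2.1.2, (p : Plaquette d L).2.1.1) 1 -
        Pi.single ((p : Plaquette d L).1, (p : Plaquette d L).2.1.2) 1 : Edge d L → ℚ)) :=
    hliM.comp (fun p : F => (⟨(p : Plaquette d L), hF p.2⟩ : Mo))
      (fun a b hab => Subtype.ext (by simpa using congrArg Subtype.val hab))
  have hmem' : ∀ p : F, (Pi.single ((p : Plaquette d L).1, (p : Plaquette d L).2.1.1) 1 +
        Pi.single ((p : Plaquette d L).1.shift (p : Plaquette d L).2.1.1, (p : Plaquette d L).2.1.2) 1 -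
        Pi.single ((p : Plaquette d L).1.shift (p : Plaquette d L).2.1.2, (p : Plaquette d L).2.1.1) 1 -
        Pi.single ((p : Plaquette d L).1, (p : Plaquette d L).2.1.2) 1 : Edge d L → ℚ) ∈ W :=
    fun p => hmem p p.2
  have hliW : LinearIndependent ℚ (fun p : F => (⟨_, hmem' p⟩ : W)) := by
    apply LinearIndependent.of_comp W.subtype
    exact hliF
  have h1 := hliW.fintype_card_le_finrank
  have h2 : Module.finrank ℚ W ≤ B.card := by
    have h := finrank_range_le_card (R := ℚ) (fun p : B =>
      (Pi.single ((p : Plaquette d L).1, (p : Plaquette d L).2.1.1) 1 +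
        Pi.single ((p : Plaquette d L).1.shift (p : Plaquette d L).2.1.1, (p : Plaquette d L).2.1.2) 1 -
        Pi.single ((p : Plaquette d L).1.shift (p : Plaquette d L).2.1.2, (p : Plaquette d L).2.1.1) 1 -
        Pi.single ((p : Plaquette d L).1, (p : Plaquette d L).2.1.2) 1 : Edge d L → ℚ))
    rw [Fintype.card_coe] at h
    exact h
  rw [Fintype.card_coe] at h1
  exact h1.trans h2

/-- **AT LEAST `(d−1)(L^d − 1) − #B` PLAQUETTES ARE NOT DETERMINED BY `B`.**  `L ≥ 2`; `B` any collection of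
plaquettes of `(ℤ/L)^d`; `G` commutative with some `g^n ≠ 1` for each `n ≠ 0`.  There is a set `D` of plaquettes
outside `B` with `#D + #B ≥ (d−1)(L^d − 1)` such that for EVERY `p' ∈ D` two `G`-configurations have the same
holonomy around every `p ∈ B` and different holonomies around `p'`. [ours] -/
theorem exists_card_not_determined (hL : 2 ≤ L) (B : Finset (Plaquette d L)) {G : Type*} [CommGroup G]
    (hG : ∀ n : ℤ, n ≠ 0 → ∃ g : G, g ^ n ≠ 1) :
    ∃ D : Finset (Plaquette d L), (d - 1) * (L ^ d - 1) ≤ D.card + B.card ∧ (∀ p' ∈ D, p' ∉ B) ∧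
      ∀ p' ∈ D, ∃ U V : GaugeConfig d L G,
        (∀ p ∈ B, plaquetteHolonomy U p.1 p.2.1.1 p.2.1.2 = plaquetteHolonomy V p.1 p.2.1.1 p.2.1.2) ∧
        plaquetteHolonomy U p'.1 p'.2.1.1 p'.2.1.2 ≠ plaquetteHolonomy V p'.1 p'.2.1.1 p'.2.1.2 := by
  classical
  obtain ⟨Mo, t, rank, -, ht, hrank, -, hcard⟩ := exists_ranked_card_compl_eq (d := d) hL
  set W := Submodule.span ℚ (Set.range fun p : B =>
        (Pi.single ((p : Plaquette d L).1, (p : Plaquette d L).2.1.1) 1 +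
        Pi.single ((p : Plaquette d L).1.shift (p : Plaquette d L).2.1.1, (p : Plaquette d L).2.1.2) 1 -
        Pi.single ((p : Plaquette d L).1.shift (p : Plaquette d L).2.1.2, (p : Plaquette d L).2.1.1) 1 -
        Pi.single ((p : Plaquette d L).1, (p : Plaquette d L).2.1.2) 1 : Edge d L → ℚ)) with hW
  set D := Mo.filter (fun p' : Plaquette d L => (Pi.single (p'.1, p'.2.1.1) 1 + Pi.single (p'.1.shift p'.2.1.1, p'.2.1.2) 1 -
        Pi.single (p'.1.shift p'.2.1.2, p'.2.1.1) 1 - Pi.single (p'.1, p'.2.1.2) 1 : Edge d L → ℚ) ∉ W) with hD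
  have hle := card_le_of_signedBoundary_mem_span hL Mo t ht rank hrank B
    (Mo.filter (fun p' : Plaquette d L => (Pi.single (p'.1, p'.2.1.1) 1 + Pi.single (p'.1.shift p'.2.1.1, p'.2.1.2) 1 -
        Pi.single (p'.1.shift p'.2.1.2, p'.2.1.1) 1 - Pi.single (p'.1, p'.2.1.2) 1 : Edge d L → ℚ) ∈ W)) (Finset.filter_subset _ _)
    (fun p' hp' => (Finset.mem_filter.1 hp').2)
  have hsplit := Finset.card_filter_add_card_filter_not
    (s := Mo) (fun p' : Plaquette d L => (Pi.single (p'.1, p'.2.1.1) 1 + Pi.single (p'.1.shift p'.2.1.1, p'.2.1.2) 1 -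
        Pi.single (p'.1.shift p'.2.1.2, p'.2.1.1) 1 - Pi.single (p'.1, p'.2.1.2) 1 : Edge d L → ℚ) ∈ W)
  have hcert : ∀ p' ∈ D, ∃ θ : Edge d L → ℤ,
      (∀ p ∈ B, ∑ e, θ e * (Pi.single (p.1, p.2.1.1) 1 + Pi.single (p.1.shift p.2.1.1, p.2.1.2) 1 -
        Pi.single (p.1.shift p.2.1.2, p.2.1.1) 1 - Pi.single (p.1, p.2.1.2) 1 : Edge d L → ℤ) e = 0) ∧
      ∑ e, θ e * (Pi.single (p'.1, p'.2.1.1) 1 + Pi.single (p'.1.shift p'.2.1.1, p'.2.1.2) 1 -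
        Pi.single (p'.1.shift p'.2.1.2, p'.2.1.1) 1 - Pi.single (p'.1, p'.2.1.2) 1 : Edge d L → ℤ) e ≠ 0 :=
    fun p' hp' => exists_int_certificate_of_notMem_span B p' (Finset.mem_filter.1 hp').2
  refine ⟨D, ?_, fun p' hp' hmem => ?_, fun p' hp' => ?_⟩
  · rw [hcard] at hsplit
    rw [← hD] at hsplit
    omega
  · obtain ⟨θ, hB, hne⟩ := hcert p' hp'
    exact hne (hB p' hmem)
  · obtain ⟨θ, hB, hne⟩ := hcert p' hp'
    obtain ⟨g, hg⟩ := hG _ hne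
    refine ⟨fun e => g ^ θ e, fun _ => 1, fun p hp => ?_, ?_⟩
    · rw [plaquetteHolonomy_zpow_config, hB p hp, zpow_zero, plaquetteHolonomy_one_config]
    · rw [plaquetteHolonomy_zpow_config, plaquetteHolonomy_one_config]
      exact hg

end Summit.Ventures.LatticeQCDFlow.Theory2.Autoregressive
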